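import Mathlib.NumberTheory.DirichletCharacter.Basic
import Mathlib.Data.Nat.Totient
import Mathlib.FieldTheory.Finite.Basic
import HarnessLib

set_option autoImplicit false

/-!
# The kernel of `(ℤ/2^{n+1})ˣ → (ℤ/2^n)ˣ` is `{1, 1 + 2^n}`, and a character of level `2^{n+1}` not factoring through `2^n`
# is `−1` at `γ₀ = 1 + 2^n`

Elementary `2`-power conductor bookkeeping (the prime-`2` sibling of the tree's private
`Literature.AlgebraicGeometry.ComplexMultiplication.CyclotomicFermatCMTypesCompositeLevel.card_ker_unitsMap`), typed generically for
the BSD cell `bsd-print-cf2` (typer `bsd-print-cf2-ty2` g45; port P53 of STUB-PLAN `stub_heegnerIndexLowerAtTwo`, leaf R219-INST₂ «γ₀-CHARACTER»,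
B72; sketch k2-g41 `cd4b39d39d1ff210` §C; the REFL-table sum and the root-of-unity index side are filed Summits-side with the SHIFT₂ port).
Everything is PROVED; no named fact, no `sorry`.  Source for the group-theoretic input (`(1 + 2^{l-1})² ≡ 1 (2^l)`, `#U(ℤ/2^l) = 2^{l-1}`): [cite: IrelandRosen1990, Ch. 4 §1 Thm 2′ and its proof, congruence (1) (PDF p. 57)].

* §1 `one_add_two_pow_sq`, `card_ker_unitsMap_two_pow`, `gammaZero`, `val_gammaZero`, `gammaZero_mem_ker`, `gammaZero_ne_one`,
  `gammaZero_mul_self`, ★ `mem_ker_unitsMap_iff` (the kernel is `{1, γ₀}`).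
* §2 ★ `apply_one_add_two_pow_eq_neg_one` (`χ(γ₀) = −1` for `χ` of level `2^{n+1}` not factoring through `2^n`), `apply_gammaZero_eq_neg_one`,
  `not_factorsThrough_iff_apply_eq_neg_one`.
-/

namespace Literature.NumberTheory.LFunctions.TwoPowerConductor

/-! ## §1. The kernel of `(ℤ/2^{n+1})ˣ → (ℤ/2^n)ˣ` -/


/-- `γ₀ = 1 + 2^n` is an involution of `ℤ/2^{n+1}` for `n ≥ 1` (`(1+2^n)² = 1 + 2^{n+1} + 2^{2n}`)
[cite: IrelandRosen1990, Ch. 4 §1 Thm 2′ and its proof, congruence (1) (PDF p. 57)]. -/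
theorem one_add_two_pow_sq {n : ℕ} (hn : 1 ≤ n) : ((1 + 2 ^ n : ZMod (2 ^ (n + 1)))) ^ 2 = 1 := by
  have h : ((2 ^ (n + 1) : ℕ) : ZMod (2 ^ (n + 1))) = 0 := ZMod.natCast_self _
  obtain ⟨k, rfl⟩ : ∃ k, n = k + 1 := ⟨n - 1, by omega⟩
  have e : ((1 + 2 ^ (k + 1) : ZMod (2 ^ (k + 1 + 1)))) ^ 2 =
      1 + ((2 ^ (k + 1 + 1) : ℕ) : ZMod (2 ^ (k + 1 + 1))) * (1 + 2 ^ k) := by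
    push_cast; ring
  rw [e, h, zero_mul, add_zero]

/-- `#ker((ℤ/2^{n+1})ˣ → (ℤ/2^n)ˣ) = 2` for `n ≥ 1` (index of a surjection, `φ(2^{n+1}) = 2·φ(2^n)`; pattern of the
tree's private `CyclotomicFermatCMTypes….card_ker_unitsMap`, here at the prime `2`)
[cite: IrelandRosen1990, Ch. 4 §1 Thm 2′ and its proof, congruence (1) (PDF p. 57)]. -/
theorem card_ker_unitsMap_two_pow {n : ℕ} (hn : 1 ≤ n) :
    Nat.card (ZMod.unitsMap (pow_dvd_pow 2 (Nat.le_succ n))).ker = 2 := by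
  set f := ZMod.unitsMap (pow_dvd_pow 2 (Nat.le_succ n)) with hf
  have hsurj : Function.Surjective f := ZMod.unitsMap_surjective _
  have h1 : f.ker.index = Nat.card (ZMod (2 ^ n))ˣ := by
    rw [Subgroup.index_ker, MonoidHom.range_eq_top_of_surjective f hsurj, Subgroup.card_top]
  have h2 := f.ker.card_mul_index
  rw [h1, Nat.card_eq_fintype_card (α := (ZMod (2 ^ n))ˣ),
    Nat.card_eq_fintype_card (α := (ZMod (2 ^ (n + 1)))ˣ), ZMod.card_units_eq_totient,
    ZMod.card_units_eq_totient, Nat.totient_prime_pow Nat.prime_two hn,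
    Nat.totient_prime_pow Nat.prime_two (by omega)] at h2
  have hpos : 0 < 2 ^ (n - 1) * (2 - 1) := by positivity
  have h3 : 2 ^ (n + 1 - 1) * (2 - 1) = 2 * (2 ^ (n - 1) * (2 - 1)) := by
    rw [← mul_assoc, ← pow_succ']
    congr 2
    omega
  rw [h3] at h2
  exact Nat.eq_of_mul_eq_mul_right hpos h2

/-- `γ₀ = 1 + 2^n` as a unit of `ℤ/2^{n+1}` (`γ₀² = 1`, `one_add_two_pow_sq`) [cite: IrelandRosen1990, Ch. 4 §1 Thm 2′ and its proof, congruence (1) (PDF p. 57)]. -/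
def gammaZero {n : ℕ} (hn : 1 ≤ n) : (ZMod (2 ^ (n + 1)))ˣ :=
  Units.mkOfMulEqOne (1 + 2 ^ n) (1 + 2 ^ n) (by rw [← sq]; exact one_add_two_pow_sq hn)

/-- `(γ₀ : ℤ/2^{n+1}) = 1 + 2^n` [cite: IrelandRosen1990, Ch. 4 §1 Thm 2′ and its proof, congruence (1) (PDF p. 57)]. -/
@[simp] theorem val_gammaZero {n : ℕ} (hn : 1 ≤ n) :
    ((gammaZero hn : (ZMod (2 ^ (n + 1)))ˣ) : ZMod (2 ^ (n + 1))) = 1 + 2 ^ n :=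
  Units.val_mkOfMulEqOne _

/-- `γ₀` lies in the kernel of the reduction `(ℤ/2^{n+1})ˣ → (ℤ/2^n)ˣ` [cite: IrelandRosen1990, Ch. 4 §1 Thm 2′ and its proof, congruence (1) (PDF p. 57)]. -/
theorem gammaZero_mem_ker {n : ℕ} (hn : 1 ≤ n) :
    gammaZero hn ∈ (ZMod.unitsMap (pow_dvd_pow 2 (Nat.le_succ n))).ker := by
  have h0 : (2 : ZMod (2 ^ n)) ^ n = 0 := by exact_mod_cast ZMod.natCast_self (2 ^ n)
  rw [MonoidHom.mem_ker, Units.ext_iff, ZMod.unitsMap_def, Units.coe_map, val_gammaZero, Units.val_one,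
    MonoidHom.coe_coe, map_add, map_one, map_pow, map_ofNat, h0, add_zero]

/-- `γ₀ ≠ 1` (`2^n ≢ 0 (mod 2^{n+1})`) [cite: IrelandRosen1990, Ch. 4 §1 Thm 2′ and its proof, congruence (1) (PDF p. 57)]. -/
theorem gammaZero_ne_one {n : ℕ} (hn : 1 ≤ n) : gammaZero hn ≠ 1 := by
  intro h
  have h' := congrArg (fun u : (ZMod (2 ^ (n + 1)))ˣ => (u : ZMod (2 ^ (n + 1)))) h
  simp only [val_gammaZero, Units.val_one, add_eq_left] at h'
  have h2n : ((2 ^ n : ℕ) : ZMod (2 ^ (n + 1))) ≠ 0 := by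
    rw [Ne, ZMod.natCast_eq_zero_iff]
    intro hd
    have := Nat.le_of_dvd (by positivity) hd
    have : 2 ^ n < 2 ^ (n + 1) := Nat.pow_lt_pow_right (by norm_num) (by omega)
    omega
  exact h2n (by exact_mod_cast h')

/-- ★ The kernel of `(ℤ/2^{n+1})ˣ → (ℤ/2^n)ˣ` is exactly `{1, γ₀}` [cite: IrelandRosen1990, Ch. 4 §1 Thm 2′ and its proof, congruence (1) (PDF p. 57)]. -/
theorem mem_ker_unitsMap_iff {n : ℕ} (hn : 1 ≤ n) (t : (ZMod (2 ^ (n + 1)))ˣ) :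
    t ∈ (ZMod.unitsMap (pow_dvd_pow 2 (Nat.le_succ n))).ker ↔ t = 1 ∨ t = gammaZero hn := by
  classical
  constructor
  · intro ht
    by_contra hne
    rw [not_or] at hne
    -- three distinct elements `1, γ₀, t` in a group of order `2`
    have hcard := card_ker_unitsMap_two_pow hn
    set K := (ZMod.unitsMap (pow_dvd_pow 2 (Nat.le_succ n))).ker
    haveI : Fintype K := Fintype.ofFinite K
    have h3 : ({⟨1, K.one_mem⟩, ⟨gammaZero hn, gammaZero_mem_ker hn⟩, ⟨t, ht⟩} : Finset K).card ≤
        Fintype.card K := Finset.card_le_univ _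
    rw [← Nat.card_eq_fintype_card, hcard] at h3
    rw [Finset.card_insert_of_notMem, Finset.card_insert_of_notMem, Finset.card_singleton] at h3
    · omega
    · simp only [Finset.mem_singleton, Subtype.mk.injEq]; exact fun h => hne.2 h.symm
    · simp only [Finset.mem_insert, Finset.mem_singleton, Subtype.mk.injEq]
      rintro (h | h)
      · exact gammaZero_ne_one hn h.symm
      · exact hne.1 h.symm
  · rintro (rfl | rfl)
    · exact (ZMod.unitsMap _).ker.one_mem
    · exact gammaZero_mem_ker hn

/-! ## §2. A character of level `2^{n+1}` not factoring through `2^n` is `−1` at `γ₀` -/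

/-- ★ **B72 in kernel, general `n` (character half):** a character of `(ℤ/2^{n+1})` (values in any domain) that does
NOT factor through `2^n` — e.g. one of conductor exactly `2^{n+1}` — is `−1` at `γ₀ = 1 + 2^n`.  (`n = 1`: `χ₄(3) = −1`;
`n = 2`: `χ₈(5) = χ₈'(5) = −1`.)  Mathlib `DirichletCharacter.factorsThrough_iff_ker_unitsMap` + §1
[cite: IrelandRosen1990, Ch. 4 §1 Thm 2′ and its proof, congruence (1) (PDF p. 57)]. -/
theorem apply_one_add_two_pow_eq_neg_one {R : Type*} [CommRing R] [IsDomain R] {n : ℕ} (hn : 1 ≤ n)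
    (χ : DirichletCharacter R (2 ^ (n + 1))) (hχ : ¬χ.FactorsThrough (2 ^ n)) :
    χ (1 + 2 ^ n) = -1 := by
  classical
  have hdvd : 2 ^ n ∣ 2 ^ (n + 1) := pow_dvd_pow 2 (Nat.le_succ n)
  rw [DirichletCharacter.factorsThrough_iff_ker_unitsMap hdvd, SetLike.not_le_iff_exists] at hχ
  obtain ⟨t, htK, htχ⟩ := hχ
  rcases (mem_ker_unitsMap_iff hn t).mp htK with rfl | rfl
  · exact absurd (MonoidHom.ker _).one_mem htχ
  · -- `χ(γ₀) ≠ 1` and `χ(γ₀)² = χ(γ₀²) = 1`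
    have hne : χ (1 + 2 ^ n) ≠ 1 := by
      intro h1
      apply htχ
      rw [MonoidHom.mem_ker]
      ext
      rw [MulChar.coe_toUnitHom, val_gammaZero, Units.val_one, h1]
    have hsq : χ (1 + 2 ^ n) * χ (1 + 2 ^ n) = 1 := by
      rw [← map_mul, ← sq, one_add_two_pow_sq hn, map_one]
    rcases mul_self_eq_one_iff.mp hsq with h | h
    · exact absurd h hne
    · exact h

/-- `γ₀ · γ₀ = 1` [cite: IrelandRosen1990, Ch. 4 §1 Thm 2′ and its proof, congruence (1) (PDF p. 57)]. -/
theorem gammaZero_mul_self {n : ℕ} (hn : 1 ≤ n) : gammaZero hn * gammaZero hn = 1 :=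
  Units.ext (by rw [Units.val_mul, val_gammaZero, Units.val_one, ← sq]; exact one_add_two_pow_sq hn)

/-- For every `n ≥ 1` and every character of level `2^{n+1}` NOT factoring through `2^n`, `χ(γ₀) = −1`, in the
`Units`-currency [cite: IrelandRosen1990, Ch. 4 §1 Thm 2′ and its proof, congruence (1) (PDF p. 57)]. -/
theorem apply_gammaZero_eq_neg_one {R : Type*} [CommRing R] [IsDomain R] {n : ℕ} (hn : 1 ≤ n)
    (χ : DirichletCharacter R (2 ^ (n + 1))) (hχ : ¬χ.FactorsThrough (2 ^ n)) :
    χ ((gammaZero hn : (ZMod (2 ^ (n + 1)))ˣ) : ZMod (2 ^ (n + 1))) = -1 := by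
  rw [val_gammaZero]; exact apply_one_add_two_pow_eq_neg_one hn χ hχ

/-- ★ …and conversely (away from characteristic 2 of the VALUE ring): `χ(1 + 2^n) = −1` iff `χ` does not factor
through `2^n` — so "exact conductor `2^{n+1}`" and "`χ(γ₀) = −1`" are the same condition on level-`2^{n+1}`
characters [cite: IrelandRosen1990, Ch. 4 §1 Thm 2′ and its proof, congruence (1) (PDF p. 57)]. -/
theorem not_factorsThrough_iff_apply_eq_neg_one {R : Type*} [CommRing R] [IsDomain R] {n : ℕ} (hn : 1 ≤ n)
    (χ : DirichletCharacter R (2 ^ (n + 1))) (h2 : (2 : R) ≠ 0) :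
    ¬χ.FactorsThrough (2 ^ n) ↔ χ (1 + 2 ^ n) = -1 := by
  refine ⟨apply_one_add_two_pow_eq_neg_one hn χ, fun hval hft => ?_⟩
  have hmem := (DirichletCharacter.factorsThrough_iff_ker_unitsMap (pow_dvd_pow 2 (Nat.le_succ n))).mp hft
    (gammaZero_mem_ker hn)
  rw [MonoidHom.mem_ker, Units.ext_iff, MulChar.coe_toUnitHom, val_gammaZero, Units.val_one, hval] at hmem
  apply h2
  calc (2 : R) = 1 - (-1) := by norm_num
    _ = 0 := by rw [hmem, sub_self]

end Literature.NumberTheory.LFunctions.TwoPowerConductor
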